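import Summits.RiemannHypothesis.RiemannHypothesis.Theorems.WeilFormatCSoundness
import Summits.RiemannHypothesis.RiemannHypothesis.Theorems.WeilFormatCSectorKernels
import HarnessLib

/-!
# Format C: two sector certificates ⟹ `WeilPositivityOn a` (the end-to-end statement)

Route context: Fourier–Galerkin / Schur-complement certificates of Weil positivity on a window ("format C";
cell memo `run/shared/lean/pub/rh-explicit/rh-explicit-weil-10/FORMATC-DESIGN.md` §1; supporting
stmt-RiemannHypothesis-0098; seat rh-explicit-weil-10).  Composition of `WeilFormatCSoundness.lean`
(`sum_range_mul_mul_nonneg_of_certificate_sum`: block certificate + far diagonal bound + coupling majorant ⟹ the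
sector kernel is a nonnegative form on every truncation) with `WeilFormatCSectorKernels.lean`
(`weilPositivityOn_of_sector_kernels_nonneg`: both sector kernels nonnegative ⟹ the rung), for an abstract real Gram
kernel `G : ℤ → ℤ → ℝ` of the window form on Yoshida's basis (`weilWindowSesq a χ_m χ_n = ↑(G m n)`; for
`G = Yoshida1992.gramCoeff a` this is weil-2's entry theorem L-C1).

* `evenKernel_symm`, `oddKernel_symm` — the sector kernels
  `M⁺_G(n,m) = if n = 0 then G(0,m) else if m = 0 then G(n,0) else (G(n,m) + G(n,−m))/2` and
  `M⁻_G(k,l) = (G(k+1,l+1) − G(k+1,−(l+1)))/2` are symmetric when `G` is symmetric and reflection-symmetric;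
* `weilPositivityOn_of_formatC_certificates` — **the statement a rung's format-C data files instantiate**:
  per sector a block size `B`, a positive far diagonal `d̂` on `m ≥ B`, a real `B × B` majorant `U`, the two analytic
  hypotheses (L-C3a far bound, L-C3b coupling majorant, on every truncation `Ico B N`) and the kernel-decided
  certificate `∀ x, 0 ≤ Σ_{i,j<B} x_i x_j (M(i,j) − U_{ij})` (`PsdDyadic.psd_of_checkPsdMid` shape) ⟹ `WeilPositivityOn a`.

NORMALISATION NOTE for the data pipeline (FORMATC-DESIGN §9): these kernels are weil-2's `SectorSplit` matrices — off
the zero mode `M⁺ = W⁺/2` and `M⁻(k,l) = W⁻(k+1,l+1)/2` relative to the orthonormal sector bases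
`(χ_n ± χ_{−n})/√2` of Yoshida (6.10) used by the Arb producer; the zero-mode row of `M⁺` is `G(0,m)` (`= W⁺(0,m)/√2`).
Pure composition; standard axioms; no definitions; no RH claim.
-/

set_option autoImplicit false
-- `Summit.RiemannHypothesis.RiemannHypothesis.…` is the layout-mandated namespace (summit = problem name).
set_option linter.dupNamespace false

noncomputable section

open Complex Finset Matrix
open scoped Real ComplexConjugate BigOperators

namespace Summit.RiemannHypothesis.RiemannHypothesis.Theorems.WeilFormatC

open Literature.NumberTheory.LFunctions
open Literature.NumberTheory.LFunctions.Yoshida1992 (modes chi)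

/-- The EVEN sector kernel `M⁺_G` of a symmetric, reflection-symmetric real kernel `G` is symmetric. -/
theorem evenKernel_symm (G : ℤ → ℤ → ℝ) (hsymm : ∀ n m, G n m = G m n) (hrefl : ∀ n m, G (-n) (-m) = G n m)
    (n m : ℕ) :
    (if n = 0 then G 0 m else if m = 0 then G n 0 else (G n m + G n (-(m : ℤ))) / 2)
      = (if m = 0 then G 0 n else if n = 0 then G m 0 else (G m n + G m (-(n : ℤ))) / 2) := by
  by_cases hn : n = 0
  · subst hn
    by_cases hm : m = 0
    · subst hm; simp
    · simp only [if_true, if_neg hm, Nat.cast_zero]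
      exact hsymm _ _
  · by_cases hm : m = 0
    · subst hm
      simp only [if_neg hn, if_true, Nat.cast_zero]
      exact hsymm _ _
    · simp only [if_neg hn, if_neg hm]
      have h1 : G n m = G m n := hsymm n m
      have h2 : G n (-(m : ℤ)) = G m (-(n : ℤ)) := by
        rw [hsymm, ← hrefl, neg_neg]
      rw [h1, h2]

/-- The ODD sector kernel `M⁻_G` of a symmetric, reflection-symmetric real kernel `G` is symmetric. -/
theorem oddKernel_symm (G : ℤ → ℤ → ℝ) (hsymm : ∀ n m, G n m = G m n) (hrefl : ∀ n m, G (-n) (-m) = G n m)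
    (k l : ℕ) :
    (G ((k : ℤ) + 1) ((l : ℤ) + 1) - G ((k : ℤ) + 1) (-((l : ℤ) + 1))) / 2
      = (G ((l : ℤ) + 1) ((k : ℤ) + 1) - G ((l : ℤ) + 1) (-((k : ℤ) + 1))) / 2 := by
  have h1 : G ((k : ℤ) + 1) ((l : ℤ) + 1) = G ((l : ℤ) + 1) ((k : ℤ) + 1) := hsymm _ _
  have h2 : G ((k : ℤ) + 1) (-((l : ℤ) + 1)) = G ((l : ℤ) + 1) (-((k : ℤ) + 1)) := by
    rw [hsymm, ← hrefl, neg_neg]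
  rw [h1, h2]

variable {a : ℝ}

/-- **Format C: two sector certificates ⟹ a rung.**  Let `a > 0`, `G : ℤ → ℤ → ℝ` the real Gram kernel of the
window form on Yoshida's basis (`weilWindowSesq a χ_m χ_n = ↑(G m n)`), symmetric and reflection-symmetric, with
sector kernels `M⁺ = M⁺_G`, `M⁻ = M⁻_G` (module docstring).  Suppose for the EVEN sector: a block size `B`, a far
diagonal `d̂ > 0` on `m ≥ B`, a real `B × B` matrix `U` with
(L-C3a) `Σ_{B≤n<N} d̂_n y_n² ≤ Σ_{B≤n,m<N} y_n M⁺(n,m) y_m` for all `N, y`;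
(L-C3b) `Σ_{B≤m<N} (Σ_{i<B} M⁺(i,m) x_i)²/d̂_m ≤ xᵀUx` for all `N, x`;
(P) `0 ≤ Σ_{i,j<B} x_i x_j (M⁺(i,j) − U_{ij})` for all `x` — and the same three for the ODD sector.  Then
`WeilPositivityOn a`. -/
theorem weilPositivityOn_of_formatC_certificates (ha : 0 < a) (G : ℤ → ℤ → ℝ)
    (hG : ∀ m n : ℤ, weilWindowSesq a (chi a m) (chi a n) = ((G m n : ℝ) : ℂ))
    (hsymm : ∀ n m, G n m = G m n) (hrefl : ∀ n m, G (-n) (-m) = G n m)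
    -- even sector
    (Be : ℕ) (de : ℕ → ℝ) (Ue : Matrix (Fin Be) (Fin Be) ℝ) (hde : ∀ m, Be ≤ m → 0 < de m)
    (hfar_e : ∀ (N : ℕ) (y : ℕ → ℝ),
      ∑ n ∈ Ico Be N, de n * y n ^ 2 ≤ ∑ n ∈ Ico Be N, ∑ m ∈ Ico Be N,
        y n * (if n = 0 then G 0 m else if m = 0 then G n 0 else (G n m + G n (-(m : ℤ))) / 2) * y m)
    (hU_e : ∀ (N : ℕ) (x : Fin Be → ℝ),
      ∑ m ∈ Ico Be N, (∑ i : Fin Be,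
        (if (i : ℕ) = 0 then G 0 m else if m = 0 then G i 0 else (G i m + G i (-(m : ℤ))) / 2) * x i) ^ 2
          / de m ≤ x ⬝ᵥ Ue *ᵥ x)
    (hS_e : ∀ x : Fin Be → ℝ, 0 ≤ ∑ i, ∑ j, x i * x j *
      ((if (i : ℕ) = 0 then G 0 j else if (j : ℕ) = 0 then G i 0 else (G i j + G i (-(j : ℤ))) / 2) - Ue i j))
    -- odd sector
    (Bo : ℕ) («do» : ℕ → ℝ) (Uo : Matrix (Fin Bo) (Fin Bo) ℝ) (hdo : ∀ m, Bo ≤ m → 0 < «do» m)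
    (hfar_o : ∀ (N : ℕ) (z : ℕ → ℝ),
      ∑ k ∈ Ico Bo N, «do» k * z k ^ 2 ≤ ∑ k ∈ Ico Bo N, ∑ l ∈ Ico Bo N,
        z k * ((G ((k : ℤ) + 1) ((l : ℤ) + 1) - G ((k : ℤ) + 1) (-((l : ℤ) + 1))) / 2) * z l)
    (hU_o : ∀ (N : ℕ) (x : Fin Bo → ℝ),
      ∑ l ∈ Ico Bo N, (∑ i : Fin Bo,
        ((G ((i : ℤ) + 1) ((l : ℤ) + 1) - G ((i : ℤ) + 1) (-((l : ℤ) + 1))) / 2) * x i) ^ 2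
          / «do» l ≤ x ⬝ᵥ Uo *ᵥ x)
    (hS_o : ∀ x : Fin Bo → ℝ, 0 ≤ ∑ i, ∑ j, x i * x j *
      ((G ((i : ℤ) + 1) ((j : ℤ) + 1) - G ((i : ℤ) + 1) (-((j : ℤ) + 1))) / 2 - Uo i j)) :
    WeilPositivityOn a := by
  refine weilPositivityOn_of_sector_kernels_nonneg ha G hG hrefl (fun K y ↦ ?_) (fun K z ↦ ?_)
  · exact sum_range_mul_mul_nonneg_of_certificate_sum
      (fun n m : ℕ ↦ if n = 0 then G 0 m else if m = 0 then G n 0 else (G n m + G n (-(m : ℤ))) / 2)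
      (fun n m ↦ evenKernel_symm G hsymm hrefl n m) Be de Ue hde hfar_e hU_e hS_e K y
  · exact sum_range_mul_mul_nonneg_of_certificate_sum
      (fun k l : ℕ ↦ (G ((k : ℤ) + 1) ((l : ℤ) + 1) - G ((k : ℤ) + 1) (-((l : ℤ) + 1))) / 2)
      (fun k l ↦ oddKernel_symm G hsymm hrefl k l) Bo «do» Uo hdo hfar_o hU_o hS_o K z

end Summit.RiemannHypothesis.RiemannHypothesis.Theorems.WeilFormatC

end
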